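import Literature.MathematicalPhysics.QuantumLattice.HubbardTTPrimeMultilinearBoxWordAdapters
import Literature.MathematicalPhysics.QuantumLattice.HubbardTTPrimeBoxWordExtension
import Literature.MathematicalPhysics.QuantumLattice.HubbardNNNHoppingEnergyDensityRegionBounds
import HarnessLib

/-!
# Ventures/CertifiedManyBodySolver — Certificates/HubbardSquare_transportClosure_KitVB.lean
# (hubbard-fast-reuse-1 g4, cell hubbard-fast, D-0154 (A) CERTIFICATE REUSE: the TRANSPORT-CLOSURE kit, part «VB» = VARBOX / BE5
# PLANE adapters — a variational-plane HYPOTHESIS taken BY VALUE becomes an `n`-slice cap partner of the density laws)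

A VARBOX-type cap plane is the hypothesis shape used by hubbard-box-eng-2's cell words for a variational witness state at one
density `m` (its energy is affine in `(t', U)`; the `t'`-edge is sign-aware):
`∀ t' U, 0 ≤ U → e(t, t', U, m) ≤ A + max (t'·B_lo) (t'·B_hi) + U·D`.
On a `(U, t')`-rectangle with `U ≥ 0` and `t' ≤ 0` (resp. `t' ≥ 0`) and `B_lo ≤ B_hi` the `max` is the `B_lo` (resp. `B_hi`)
branch, so the plane is exactly a bilinear (`U·s`-free) `n`-slice cap in the shape consumed by `tc_mlCap_nchord`,
`tc_mlFloor_nsecxL/R` (cap partner) of `…_KitLaws` / `…_KitN2`: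
* `tc_sliceN_cap_vbplane_neg` — the `t' ≤ 0` branch;  * `tc_sliceN_cap_vbplane_pos` — the `t' ≥ 0` branch;
* `tc_sliceN_cap_vbplane_phImage_neg/_pos` — the same plane read through the exact particle–hole map as a cap slice at density `2 - m`.
HONEST FRAMING: bookkeeping adapters; they certify nothing by themselves; a consumer word that cites a plane BY VALUE carries the
plane as an explicit hypothesis (producer-certified CANDIDATE ceiling until replayed); no number of record; not a phase word;
no summit statement is proved here; not a superconductivity verdict.
-/

namespace Summit.Ventures.CertifiedManyBodySolver.Certificates

open Literature.MathematicalPhysics.QuantumLattice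
open Literature.MathematicalPhysics.QuantumLattice.ThermodynamicLimit
open Set

/-- **VARBOX plane as an `n`-slice cap, `t' ≤ 0` branch**: from `∀ t' U, 0 ≤ U → e(t,t',U,m) ≤ A + max (t'B_lo) (t'B_hi) + U D`
with `B_lo ≤ B_hi`, on `U ∈ [Ua, Ub]` (`Ua ≥ 0`), `s ∈ [s₁, s₂]` (`s₂ ≤ 0`): `e(t,s,U,m) ≤ A + D·U + B_lo·s + 0·U·s`.
[cite: Israel1979, Thm. I.3.4] -/
theorem tc_sliceN_cap_vbplane_neg (t : ℝ) {m A Blo Bhi D Ua Ub s₁ s₂ : ℝ}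
    (hP : ∀ (t' U : ℝ), 0 ≤ U → energyDensityTT' t t' U m ≤ A + max (t' * Blo) (t' * Bhi) + U * D)
    (hUa : 0 ≤ Ua) (hs : s₂ ≤ 0) (hB : Blo ≤ Bhi) :
    ∀ U s : ℝ, Ua ≤ U → U ≤ Ub → s₁ ≤ s → s ≤ s₂ →
      energyDensityTT' t s U m ≤ A + D * U + Blo * s + 0 * U * s := by
  intro U s k1 _k2 _k3 k4
  have hU0 : 0 ≤ U := hUa.trans k1
  have hs0 : s ≤ 0 := k4.trans hs
  have h := hP s U hU0
  have hmax : max (s * Blo) (s * Bhi) ≤ s * Blo :=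
    max_le le_rfl (mul_le_mul_of_nonpos_left hB hs0)
  linarith

/-- **VARBOX plane as an `n`-slice cap, `t' ≥ 0` branch**: as `tc_sliceN_cap_vbplane_neg` with `0 ≤ s₁`; the `B_hi` branch of the
sign-aware `t'`-edge is the active one: `e(t,s,U,m) ≤ A + D·U + B_hi·s + 0·U·s`. [cite: Israel1979, Thm. I.3.4] -/
theorem tc_sliceN_cap_vbplane_pos (t : ℝ) {m A Blo Bhi D Ua Ub s₁ s₂ : ℝ}
    (hP : ∀ (t' U : ℝ), 0 ≤ U → energyDensityTT' t t' U m ≤ A + max (t' * Blo) (t' * Bhi) + U * D)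
    (hUa : 0 ≤ Ua) (hs : 0 ≤ s₁) (hB : Blo ≤ Bhi) :
    ∀ U s : ℝ, Ua ≤ U → U ≤ Ub → s₁ ≤ s → s ≤ s₂ →
      energyDensityTT' t s U m ≤ A + D * U + Bhi * s + 0 * U * s := by
  intro U s k1 _k2 k3 _k4
  have hU0 : 0 ≤ U := hUa.trans k1
  have hs0 : 0 ≤ s := hs.trans k3
  have h := hP s U hU0
  have hmax : max (s * Blo) (s * Bhi) ≤ s * Bhi :=
    max_le (mul_le_mul_of_nonneg_left hB hs0) le_rfl
  linarith

/-! ### Plane partners through the exact particle–hole map `e(t,s,U,2-m) = e(t,-s,U,m) + U(1-m)` (reuse-1 g4, second instalment) -/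

/-- **VARBOX plane imaged to density `2 - m`, target `t' ≤ 0`**: from `∀ t' U, 0 ≤ U → e(t,t',U,m) ≤ A + max (t'B_lo) (t'B_hi) + U D`
(`0 < m < 2`, `B_lo ≤ B_hi`), on `U ∈ [Ua, Ub]` (`Ua ≥ 0`), `s ∈ [s₁, s₂]` (`s₂ ≤ 0`):
`e(t,s,U,2-m) ≤ A + (D + (1 - m))·U + (-B_hi)·s + 0·U·s` (the plane is read at `-s ≥ 0`, where its `B_hi` branch is active,
and carried through `energyDensityTT'_particleHole`). [cite: LiebWuPhysicaA2003, §1 eq. (3)] -/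
theorem tc_sliceN_cap_vbplane_phImage_neg (t : ℝ) {m A Blo Bhi D Ua Ub s₁ s₂ : ℝ}
    (hP : ∀ (t' U : ℝ), 0 ≤ U → energyDensityTT' t t' U m ≤ A + max (t' * Blo) (t' * Bhi) + U * D)
    (hm0 : 0 < m) (hm2 : m < 2) (hUa : 0 ≤ Ua) (hs : s₂ ≤ 0) (hB : Blo ≤ Bhi) :
    ∀ U s : ℝ, Ua ≤ U → U ≤ Ub → s₁ ≤ s → s ≤ s₂ →
      energyDensityTT' t s U (2 - m) ≤ A + (D + (1 - m)) * U + (-Bhi) * s + 0 * U * s := by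
  intro U s k1 _k2 _k3 k4
  have hU0 : 0 ≤ U := hUa.trans k1
  have hs0 : 0 ≤ -s := by linarith [k4.trans hs]
  have h := hP (-s) U hU0
  have hmax : max (-s * Blo) (-s * Bhi) ≤ -s * Bhi :=
    max_le (mul_le_mul_of_nonneg_left hB hs0) le_rfl
  have hph := energyDensityTT'_particleHole t s hU0 (n := 2 - m) (by linarith) (by linarith)
  rw [show (2 : ℝ) - (2 - m) = m by ring] at hph
  rw [hph]
  linarith

/-- **VARBOX plane imaged to density `2 - m`, target `t' ≥ 0`**: as `tc_sliceN_cap_vbplane_phImage_neg` with `0 ≤ s₁`; the plane is read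
at `-s ≤ 0` where its `B_lo` branch is active: `e(t,s,U,2-m) ≤ A + (D + (1 - m))·U + (-B_lo)·s + 0·U·s`.
[cite: LiebWuPhysicaA2003, §1 eq. (3)] -/
theorem tc_sliceN_cap_vbplane_phImage_pos (t : ℝ) {m A Blo Bhi D Ua Ub s₁ s₂ : ℝ}
    (hP : ∀ (t' U : ℝ), 0 ≤ U → energyDensityTT' t t' U m ≤ A + max (t' * Blo) (t' * Bhi) + U * D)
    (hm0 : 0 < m) (hm2 : m < 2) (hUa : 0 ≤ Ua) (hs : 0 ≤ s₁) (hB : Blo ≤ Bhi) :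
    ∀ U s : ℝ, Ua ≤ U → U ≤ Ub → s₁ ≤ s → s ≤ s₂ →
      energyDensityTT' t s U (2 - m) ≤ A + (D + (1 - m)) * U + (-Blo) * s + 0 * U * s := by
  intro U s k1 _k2 k3 _k4
  have hU0 : 0 ≤ U := hUa.trans k1
  have hs0 : -s ≤ 0 := by linarith [hs.trans k3]
  have h := hP (-s) U hU0
  have hmax : max (-s * Blo) (-s * Bhi) ≤ -s * Blo :=
    max_le le_rfl (mul_le_mul_of_nonpos_left hB hs0)
  have hph := energyDensityTT'_particleHole t s hU0 (n := 2 - m) (by linarith) (by linarith)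
  rw [show (2 : ℝ) - (2 - m) = m by ring] at hph
  rw [hph]
  linarith


/-- **VARBOX plane imaged to an explicit target density `n₀` with `m + n₀ = 2`, target `t' ≤ 0`** (the consumer-friendly form of
`tc_sliceN_cap_vbplane_phImage_neg`: the target density is a literal the density-chord law unifies with):
`e(t,s,U,n₀) ≤ A + (D + (n₀ - 1))·U + (-B_hi)·s + 0·U·s` on `U ∈ [Ua,Ub]` (`Ua ≥ 0`), `s ≤ s₂ ≤ 0`. [cite: LiebWuPhysicaA2003, §1 eq. (3)] -/
theorem tc_sliceN_cap_vbplane_phImageAt_neg (t : ℝ) {m n₀ A Blo Bhi D Ua Ub s₁ s₂ : ℝ}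
    (hP : ∀ (t' U : ℝ), 0 ≤ U → energyDensityTT' t t' U m ≤ A + max (t' * Blo) (t' * Bhi) + U * D)
    (hmn : m + n₀ = 2) (hm0 : 0 < m) (hm2 : m < 2) (hUa : 0 ≤ Ua) (hs : s₂ ≤ 0) (hB : Blo ≤ Bhi) :
    ∀ U s : ℝ, Ua ≤ U → U ≤ Ub → s₁ ≤ s → s ≤ s₂ →
      energyDensityTT' t s U n₀ ≤ A + (D + (n₀ - 1)) * U + (-Bhi) * s + 0 * U * s := by
  intro U s k1 k2 k3 k4
  have hn : n₀ = 2 - m := by linarith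
  have h := tc_sliceN_cap_vbplane_phImage_neg t hP hm0 hm2 hUa hs hB U s k1 k2 k3 k4
  rw [hn]
  linear_combination h

/-- **VARBOX plane imaged to an explicit target density `n₀` with `m + n₀ = 2`, target `t' ≥ 0`**:
`e(t,s,U,n₀) ≤ A + (D + (n₀ - 1))·U + (-B_lo)·s + 0·U·s` on `U ∈ [Ua,Ub]` (`Ua ≥ 0`), `0 ≤ s₁ ≤ s`. [cite: LiebWuPhysicaA2003, §1 eq. (3)] -/
theorem tc_sliceN_cap_vbplane_phImageAt_pos (t : ℝ) {m n₀ A Blo Bhi D Ua Ub s₁ s₂ : ℝ}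
    (hP : ∀ (t' U : ℝ), 0 ≤ U → energyDensityTT' t t' U m ≤ A + max (t' * Blo) (t' * Bhi) + U * D)
    (hmn : m + n₀ = 2) (hm0 : 0 < m) (hm2 : m < 2) (hUa : 0 ≤ Ua) (hs : 0 ≤ s₁) (hB : Blo ≤ Bhi) :
    ∀ U s : ℝ, Ua ≤ U → U ≤ Ub → s₁ ≤ s → s ≤ s₂ →
      energyDensityTT' t s U n₀ ≤ A + (D + (n₀ - 1)) * U + (-Blo) * s + 0 * U * s := by
  intro U s k1 k2 k3 k4
  have hn : n₀ = 2 - m := by linarith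
  have h := tc_sliceN_cap_vbplane_phImage_pos t hP hm0 hm2 hUa hs hB U s k1 k2 k3 k4
  rw [hn]
  linear_combination h

end Summit.Ventures.CertifiedManyBodySolver.Certificates
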